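import Summits.AnomalousDissipation.AnomalousDissipation.Theorems.MirrorStatisticsLoudTG.Negative.LoadBearing
import Summits.AnomalousDissipation.AnomalousDissipation.Theorems.EnsembleRigidityGPStatisticalRigidityLinearTestLimit
import Summits.AnomalousDissipation.AnomalousDissipation.Theorems.PumpedMirrorMirrorFloorTGStubMirrorSlabClosed
import Summits.AnomalousDissipation.AnomalousDissipation.Theorems.PumpedMirrorMirrorFloorTGSmallEnergy
import Literature.Analysis.FunctionSpaces.PeriodicLogCost
import HarnessLib

/-!
# Tools for stub `stub_eulerCoerciveK` of line `regimes`
# (crux `MirrorEnsemble.MirrorStatisticsLoudTG`, stmt-AnomalousDissipation-17693): entry lemmas of the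
# statistical Kelvin programme

The stub `stub_eulerCoerciveK` — the Taylor–Green force `f_TG` carries NO stationary statistical solution of
the Euler equations (`ν = 0`, FMRT class) supported by the closed mirror class `Fix K` — is open. This file
lands the provable entry lemmas of its armed lever, the STATISTICAL KELVIN TUBE LAW, in the tree's vocabulary:

* `meanMomentumBalance` — MEAN MOMENTUM BALANCE: for a stationary statistical solution `μ` of Euler forced
  by `f ∈ L²` and every fixed smooth solenoidal mean-zero test field `w`, `v ↦ ⟨f − B(v,v), w⟩` is
  `μ`-integrable and `∫ ⟨f − B(v,v), w⟩ dμ = 0` (the landed cut-off removal `stub_linearTestLimit` at defect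
  `R = 0`; the energy is integrable by finite mean enstrophy and Poincaré).
* `meanReynoldsStress` — equivalently the mean Reynolds stress balances the force weakly:
  `∫∫ (v ⊗ v) : ∇w dx dμ(v) = −(f, w)`.
* `meanStress_tg`, `energyFloor_tg` — at `f = f_TG` with `w = f_TG` (`‖f_TG‖² = ¼`): every Euler statistics
  of `f_TG` has mean stress `∫∫ (v ⊗ v) : ∇f_TG = −¼` (exact anti-pumping at `ν = 0`), hence mean energy
  `e(μ) ≥ E₀ > 0` (`|∫ (v ⊗ v) : ∇f_TG| ≤ C_TG |v|²`): no Euler statistics of `f_TG` sits near rest.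
* `isClosed_mirrorClass`, `closure_mirrorClass_eq`, `ae_mem_mirrorClass` — support bookkeeping: `Fix K` is
  closed (`PumpedMirrorMirrorFloorTG.stub_mirrorSlabClosed`), so `μ((closure Fix K)ᶜ) = 0` says `v ∈ Fix K`
  `μ`-a.e.
* `tg_loop_circulation` — the KELVIN DATUM: the circulation of `f_TG` around the skeleton loop
  `C = ∂([0,½]² × {x₂ = 0})`, written as four edge integrals, equals `4/π ≠ 0`.
* `dirac_iff` — DIRAC CHARACTERISATION: `δ_u` is a K-supported Euler statistics of `f_TG` iff `u` is a
  mirror-symmetric finite-enstrophy steady `H`-weak Euler state; on Dirac masses the stub is the `H¹` form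
  of PumpedMirror's `NoSmoothMirrorDodgerTG`.
* `skeletonLaw_of_tubeInequality` — the GLUE: any deterministic tube inequality
  `|∫ (v ⊗ v) : ∇g| ≤ Λ(v)` on finite-enstrophy mirror-symmetric fields turns, for every K-supported Euler
  statistics of `f_TG`, into the mean floor `(f_TG, g) ≤ ∫ Λ dμ` — the statistical Kelvin tube law is
  exactly this with `g = g_δ` the smoothed line current of `C` and `Λ(v) = C δ⁻¹ ‖∇v‖²_{L²(N_δ(C))}`.
* `stub_eulerCoerciveKTools` — the registered tools sub-stub: the conjunction of the above.

What remains for `stub_eulerCoerciveK` (not claimed here): the deterministic tube inequality for `H¹` mirror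
fields (one-dimensional Hardy across the symmetry planes) and, beyond it, the exclusion of CUSPED K-supported
Euler statistics (`‖∇v‖²` of density `≍ dist(·, C)⁻¹`), for which the tube law is saturated.

References: C. Foias, O. Manley, R. Rosa, R. Temam, *Navier–Stokes Equations and Turbulence* (CUP 2001),
Ch. IV §1.2 Def. 1.3, (1.29)–(1.31) [FMRTTurbulence2001]; M. E. Brachet et al., *Small-scale structure of the
Taylor–Green vortex*, J. Fluid Mech. 130 (1983) 411–452, §2 (symmetries of the TG vortex, the impermeable
box `[0,½]³`) [doi:10.1017/s0022112083001159].
-/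

-- every `Summit.AnomalousDissipation.AnomalousDissipation.…` name repeats the summit = problem segment (tree layout)
set_option linter.dupNamespace false

noncomputable section

namespace Summit.AnomalousDissipation.AnomalousDissipation.Theorems.MirrorEnsembleMirrorStatisticsLoudTG

open MeasureTheory Filter Topology
open scoped ENNReal InnerProductSpace RealInnerProductSpace NNReal
open Literature.Analysis.FunctionSpaces Literature.Analysis.FluidPDE
open Summit.AnomalousDissipation.AnomalousDissipation.Theorems.TaylorGreenLoudGalerkinStates.Negative
  (tgForce isSmooth_tgForce isDivFree_tgForce hasZeroMean_tgForce integral_norm_sq_tgForce)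
open Summit.AnomalousDissipation.AnomalousDissipation.Theorems.MirrorStatisticsLoudTG.Negative
  (mirrorClass memLp_tgForce dirac_compl_closure_mirrorClass_of_mem)
open Summit.AnomalousDissipation.AnomalousDissipation.Theorems.EnsembleRigidity.GPStatisticalRigidity
  (stub_linearTestLimit)
open Summit.AnomalousDissipation.AnomalousDissipation.Theorems.GPStatisticalRigidity.Negative
  (integrable_norm_sq_of_ensembleEnstrophy_lt_top)
open Summit.AnomalousDissipation.AnomalousDissipation.Theorems.PumpedMirrorMirrorFloorTG
  (stub_mirrorSlabClosed exists_abs_inertialPairing_tg_le)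

/-- Local notation: the energy space `H` of `T³`. -/
local notation "H3" => Torus.energySpace (Fin 3)

/-! ## Mean momentum balance of an Euler statistics -/

/-- **Mean momentum balance.** For a stationary statistical solution `μ` of the Euler equations forced by
`f ∈ L²` (FMRT class at `ν = 0`) and a FIXED smooth solenoidal mean-zero field `w`, the tested generator
`v ↦ ⟨f − B(v,v), w⟩` is `μ`-integrable and `∫ ⟨f − B(v,v), w⟩ dμ = 0`: the cylindrical Liouville identity
holds at defect `R = 0`, and the cut-off is removed by `stub_linearTestLimit` (FMRT 2001, Ch. IV (1.30);
integrable energy from (1.29) by Poincaré). [folklore] -/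
theorem meanMomentumBalance :
    ∀ (f w : UnitAddTorus (Fin 3) → EuclideanSpace ℝ (Fin 3)) (μ : Measure H3), MemLp f 2 volume →
      Torus.IsSmooth w → Torus.IsDivFree w → Torus.HasZeroMean w →
      Torus.IsStationaryStatisticalSolution 0 f μ →
      Integrable (fun v : H3 => Torus.nsGeneratorPairing 0 f v w) μ ∧
        ∫ v, Torus.nsGeneratorPairing 0 f v w ∂μ = 0 := by
  intro f w μ hf hw hdw hzw hμ
  haveI := hμ.prob
  have hint : Integrable (fun v : H3 => ‖v‖ ^ 2) μ :=
    integrable_norm_sq_of_ensembleEnstrophy_lt_top μ hμ.enstrophy_finite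
  have hdef : ∀ Φ : Torus.CylindricalTest (Fin 3),
      Integrable (fun v : H3 => Torus.nsGeneratorPairing 0 f v (Φ.grad v)) μ ∧
        |∫ v, Torus.nsGeneratorPairing 0 f v (Φ.grad v) ∂μ| ≤
          0 * Real.sqrt (∫ v, Torus.gradNormSq (Φ.grad v) ∂μ) := fun Φ =>
    ⟨(hμ.generator Φ).1, by rw [(hμ.generator Φ).2, abs_zero, zero_mul]⟩
  obtain ⟨hI, hle⟩ := stub_linearTestLimit f w hf hw hdw hzw μ hμ.prob hint 0 hdef
  rw [zero_mul] at hle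
  exact ⟨hI, abs_nonpos_iff.1 hle⟩

/-- **The mean Reynolds stress balances the force.** For an Euler statistics `μ` of `f ∈ L²` and a fixed
`w ∈ 𝒱`: `v ↦ ∫ (v ⊗ v) : ∇w` is `μ`-integrable and `∫∫ (v ⊗ v) : ∇w dx dμ(v) = −(f, w)`
(`⟨f − B(v,v), w⟩ = (f, w) + ∫ (v ⊗ v) : ∇w` at `ν = 0`). [folklore] -/
theorem meanReynoldsStress :
    ∀ (f w : UnitAddTorus (Fin 3) → EuclideanSpace ℝ (Fin 3)) (μ : Measure H3), MemLp f 2 volume →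
      Torus.IsSmooth w → Torus.IsDivFree w → Torus.HasZeroMean w →
      Torus.IsStationaryStatisticalSolution 0 f μ →
      Integrable (fun v : H3 => Torus.inertialPairing
          (v : Lp (EuclideanSpace ℝ (Fin 3)) 2 (volume : Measure (UnitAddTorus (Fin 3)))) w) μ ∧
        ∫ v, Torus.inertialPairing
            (v : Lp (EuclideanSpace ℝ (Fin 3)) 2 (volume : Measure (UnitAddTorus (Fin 3)))) w ∂μ =
          -∫ x, ⟪f x, w x⟫_ℝ := by
  intro f w μ hf hw hdw hzw hμ
  haveI := hμ.prob
  obtain ⟨hI, h0⟩ := meanMomentumBalance f w μ hf hw hdw hzw hμ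
  have hrew : ∀ v : H3, Torus.inertialPairing
      (v : Lp (EuclideanSpace ℝ (Fin 3)) 2 (volume : Measure (UnitAddTorus (Fin 3)))) w =
      Torus.nsGeneratorPairing 0 f v w - ∫ x, ⟪f x, w x⟫_ℝ := fun v => by
    rw [Torus.nsGeneratorPairing, zero_mul, add_zero]
    ring
  simp_rw [hrew]
  refine ⟨hI.sub (integrable_const _), ?_⟩
  rw [integral_sub hI (integrable_const _), h0, integral_const, probReal_univ, one_smul, zero_sub]

/-! ## The Taylor–Green force: exact anti-pumping at `ν = 0` and the energy floor -/

/-- **Stress pinning for Euler statistics of `f_TG`.** Every stationary statistical solution of Euler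
forced by `f_TG` has mean Reynolds stress `∫∫ (v ⊗ v) : ∇f_TG dx dμ = −‖f_TG‖² = −¼` (the mean momentum
balance tested with `w = f_TG ∈ 𝒱`). [folklore] -/
theorem meanStress_tg :
    ∀ μ : Measure H3, Torus.IsStationaryStatisticalSolution 0 tgForce μ →
      ∫ v, Torus.inertialPairing
          (v : Lp (EuclideanSpace ℝ (Fin 3)) 2 (volume : Measure (UnitAddTorus (Fin 3)))) tgForce ∂μ =
        -4⁻¹ := by
  intro μ hμ
  rw [(meanReynoldsStress tgForce tgForce μ memLp_tgForce isSmooth_tgForce isDivFree_tgForce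
    hasZeroMean_tgForce hμ).2, ← integral_norm_sq_tgForce]
  congr 1
  exact integral_congr_ae (ae_of_all _ fun x => real_inner_self_eq_norm_sq _)

/-- **Energy floor: no Euler statistics of `f_TG` near rest.** There is `E₀ > 0` (`E₀ = 1/(4(C_TG+1))`,
`C_TG = sup_x Σᵢ ‖∂ᵢ f_TG(x)‖`) such that every stationary statistical solution of Euler forced by `f_TG` has
mean energy `e(μ) = ∫ |v|² dμ ≥ E₀`: by `meanStress_tg` and `|∫ (v ⊗ v) : ∇f_TG| ≤ C_TG |v|²`,
`¼ ≤ (C_TG + 1) e(μ)`. [folklore] -/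
theorem energyFloor_tg :
    ∃ E₀ : ℝ, 0 < E₀ ∧ ∀ μ : Measure H3, Torus.IsStationaryStatisticalSolution 0 tgForce μ →
      E₀ ≤ Torus.ensembleEnergy μ := by
  obtain ⟨C, hC0, hC⟩ := exists_abs_inertialPairing_tg_le
  refine ⟨1 / (4 * (C + 1)), by positivity, fun μ hμ => ?_⟩
  haveI := hμ.prob
  have hint : Integrable (fun v : H3 => ‖v‖ ^ 2) μ :=
    integrable_norm_sq_of_ensembleEnstrophy_lt_top μ hμ.enstrophy_finite
  obtain ⟨hIi, -⟩ := meanReynoldsStress tgForce tgForce μ memLp_tgForce isSmooth_tgForce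
    isDivFree_tgForce hasZeroMean_tgForce hμ
  have hlow : -((C + 1) * Torus.ensembleEnergy μ) ≤ ∫ v, Torus.inertialPairing
      (v : Lp (EuclideanSpace ℝ (Fin 3)) 2 (volume : Measure (UnitAddTorus (Fin 3)))) tgForce ∂μ := by
    rw [Torus.ensembleEnergy, ← integral_const_mul, ← integral_neg]
    refine integral_mono (hint.const_mul _).neg hIi fun v => ?_
    have h1 := hC v
    have h2 := neg_abs_le (Torus.inertialPairing v.1 tgForce)
    dsimp only
    nlinarith [sq_nonneg ‖v‖]
  rw [meanStress_tg μ hμ] at hlow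
  rw [div_le_iff₀ (by positivity)]
  linarith

/-! ## Support bookkeeping: the mirror class is closed -/

/-- The a.e. mirror class `Fix K ⊆ H` is closed (`PumpedMirrorMirrorFloorTG.stub_mirrorSlabClosed`, whose set is
`mirrorClass` verbatim). [folklore] -/
theorem isClosed_mirrorClass : IsClosed mirrorClass := stub_mirrorSlabClosed

/-- Hence `closure (Fix K) = Fix K`. [folklore] -/
theorem closure_mirrorClass_eq : closure mirrorClass = mirrorClass := isClosed_mirrorClass.closure_eq

/-- A measure carried by `closure (Fix K)` is carried by `Fix K`: `v ∈ Fix K` for `μ`-a.e. `v`. [folklore] -/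
theorem ae_mem_mirrorClass :
    ∀ μ : Measure H3, μ (closure mirrorClass)ᶜ = 0 → ∀ᵐ v ∂μ, v ∈ mirrorClass := by
  intro μ hμ
  rw [closure_mirrorClass_eq] at hμ
  exact mem_ae_iff.2 hμ

/-! ## The Kelvin datum: circulation of `f_TG` around the skeleton loop -/

/-- `∫₀^{1/2} sin 2πs ds = 1/π`. [folklore] -/
theorem integral_sin_two_pi_mul : ∫ s in (0 : ℝ)..(1 / 2), Real.sin (2 * Real.pi * s) = 1 / Real.pi := by
  rw [intervalIntegral.integral_comp_mul_left Real.sin (by positivity : (2 * Real.pi : ℝ) ≠ 0), integral_sin,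
    mul_zero, Real.cos_zero, show 2 * Real.pi * (1 / 2 : ℝ) = Real.pi by ring, Real.cos_pi, smul_eq_mul]
  field_simp
  norm_num

/-- The tangential component of `f_TG` along the four edges of the skeleton loop `C = ∂([0,½]² × {x₂ = 0})`,
traversed counter-clockwise, is `sin 2πs` in the edge parameter `s ∈ (0, ½)` (signs of the two reversed edges
included): `f_TG = (sin2πx₀ cos2πx₁ cos2πx₂, −cos2πx₀ sin2πx₁ cos2πx₂, 0)` and `e₁(x) = exp(2πi x)`
(`Torus.fourier_one_coe`). [folklore] -/
theorem tgForce_edges (s : ℝ) :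
    tgForce (![((s : ℝ) : UnitAddCircle), ((0 : ℝ) : UnitAddCircle), ((0 : ℝ) : UnitAddCircle)]) 0 =
        Real.sin (2 * Real.pi * s) ∧
      tgForce (![(((1 / 2 : ℝ)) : UnitAddCircle), ((s : ℝ) : UnitAddCircle), ((0 : ℝ) : UnitAddCircle)]) 1 =
        Real.sin (2 * Real.pi * s) ∧
      tgForce (![((s : ℝ) : UnitAddCircle), (((1 / 2 : ℝ)) : UnitAddCircle), ((0 : ℝ) : UnitAddCircle)]) 0 =
        -Real.sin (2 * Real.pi * s) ∧
      tgForce (![((0 : ℝ) : UnitAddCircle), ((s : ℝ) : UnitAddCircle), ((0 : ℝ) : UnitAddCircle)]) 1 =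
        -Real.sin (2 * Real.pi * s) := by
  have hπ : 2 * Real.pi * (1 / 2 : ℝ) = Real.pi := by ring
  simp only [tgForce, PiLp.toLp_apply, Matrix.cons_val_zero, Matrix.cons_val_one, Matrix.cons_val_two,
    Matrix.head_cons, Matrix.tail_cons, Torus.fourier_one_coe, Complex.exp_ofReal_mul_I_re,
    Complex.exp_ofReal_mul_I_im, mul_zero, Real.cos_zero, hπ, Real.cos_pi]
  refine ⟨by ring, by ring, by ring, by ring⟩

/-- **The Kelvin datum.** The circulation of the Taylor–Green force around the skeleton loop
`C = ∂([0,½]² × {x₂ = 0})` — edges `{x₁ = x₂ = 0}`, `{x₀ = ½, x₂ = 0}`, `{x₁ = ½, x₂ = 0}` (reversed),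
`{x₀ = 0, x₂ = 0}` (reversed), each an intersection of two mirror planes — is `∮_C f_TG · dl = 4/π ≠ 0`
(Brachet et al. 1983, §2: the impermeable box of the TG symmetries; the loop form of
`PumpedMirror.KelvinPumpSteadyTG`). [folklore] -/
theorem tg_loop_circulation :
    (∫ s in (0 : ℝ)..(1 / 2), tgForce (![((s : ℝ) : UnitAddCircle), ((0 : ℝ) : UnitAddCircle),
        ((0 : ℝ) : UnitAddCircle)]) 0) +
      (∫ s in (0 : ℝ)..(1 / 2), tgForce (![(((1 / 2 : ℝ)) : UnitAddCircle), ((s : ℝ) : UnitAddCircle),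
        ((0 : ℝ) : UnitAddCircle)]) 1) -
      (∫ s in (0 : ℝ)..(1 / 2), tgForce (![((s : ℝ) : UnitAddCircle), (((1 / 2 : ℝ)) : UnitAddCircle),
        ((0 : ℝ) : UnitAddCircle)]) 0) -
      (∫ s in (0 : ℝ)..(1 / 2), tgForce (![((0 : ℝ) : UnitAddCircle), ((s : ℝ) : UnitAddCircle),
        ((0 : ℝ) : UnitAddCircle)]) 1) = 4 / Real.pi := by
  simp_rw [fun s => (tgForce_edges s).1, fun s => (tgForce_edges s).2.1, fun s => (tgForce_edges s).2.2.1,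
    fun s => (tgForce_edges s).2.2.2, intervalIntegral.integral_neg, integral_sin_two_pi_mul]
  ring

/-! ## The glue: a deterministic tube inequality gives the statistical skeleton law -/

/-- **Skeleton law from a tube inequality.** Let `g ∈ 𝒱` and `Λ : H → [0, ∞]`. If the deterministic bound
`|∫ (v ⊗ v) : ∇g| ≤ Λ(v)` holds at every mirror-symmetric `v ∈ Fix K` of finite enstrophy, then every
stationary statistical solution of Euler forced by `f_TG` carried by `closure (Fix K)` obeys the mean floor
`(f_TG, g) ≤ ∫ Λ dμ` (mean Reynolds-stress balance `(f_TG, g) = −∫∫ (v ⊗ v) : ∇g`, finite enstrophy and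
`v ∈ Fix K` a.e.). With `g = g_δ` the smoothed unit current of the skeleton loop (`(f_TG, g_δ) → 4/π`,
`tg_loop_circulation`) and `Λ(v) = C δ⁻¹ ‖∇v‖²_{L²(N_δ(C))}` this is the statistical Kelvin tube law
`E_μ ‖∇v‖²_{L²(N_δ(C))} ≥ c δ`. [folklore] -/
theorem skeletonLaw_of_tubeInequality :
    ∀ (g : UnitAddTorus (Fin 3) → EuclideanSpace ℝ (Fin 3)) (Λ : H3 → ℝ≥0∞),
      Torus.IsSmooth g → Torus.IsDivFree g → Torus.HasZeroMean g →
      (∀ v : H3, v ∈ mirrorClass →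
        Torus.eGradNormSq ((v : Lp (EuclideanSpace ℝ (Fin 3)) 2 (volume : Measure (UnitAddTorus (Fin 3)))) :
          UnitAddTorus (Fin 3) → EuclideanSpace ℝ (Fin 3)) ≠ ⊤ →
        ENNReal.ofReal |Torus.inertialPairing
          (v : Lp (EuclideanSpace ℝ (Fin 3)) 2 (volume : Measure (UnitAddTorus (Fin 3)))) g| ≤ Λ v) →
      ∀ μ : Measure H3, μ (closure mirrorClass)ᶜ = 0 → Torus.IsStationaryStatisticalSolution 0 tgForce μ →
        ENNReal.ofReal (∫ x, ⟪tgForce x, g x⟫_ℝ) ≤ ∫⁻ v, Λ v ∂μ := by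
  intro g Λ hg hdg hzg htube μ hK hμ
  obtain ⟨hIi, hI⟩ := meanReynoldsStress tgForce g μ memLp_tgForce hg hdg hzg hμ
  -- `(f_TG, g) = -∫ I ≤ ∫ |I|`
  have h1 : ∫ x, ⟪tgForce x, g x⟫_ℝ ≤ ∫ v, |Torus.inertialPairing
      (v : Lp (EuclideanSpace ℝ (Fin 3)) 2 (volume : Measure (UnitAddTorus (Fin 3)))) g| ∂μ := by
    have h := neg_abs_le (∫ v, Torus.inertialPairing
      (v : Lp (EuclideanSpace ℝ (Fin 3)) 2 (volume : Measure (UnitAddTorus (Fin 3)))) g ∂μ)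
    have h' := abs_integral_le_integral_abs (μ := μ) (f := fun v : H3 => Torus.inertialPairing
      (v : Lp (EuclideanSpace ℝ (Fin 3)) 2 (volume : Measure (UnitAddTorus (Fin 3)))) g)
    linarith
  -- `∫ |I| ≤ ∫ Λ` almost everywhere on the carrier
  have hfin : ∀ᵐ v ∂μ, Torus.eGradNormSq (((v : H3) : Lp (EuclideanSpace ℝ (Fin 3)) 2
      (volume : Measure (UnitAddTorus (Fin 3)))) : UnitAddTorus (Fin 3) → EuclideanSpace ℝ (Fin 3)) < ⊤ :=
    ae_lt_top (Torus.measurable_eGradNormSq_coe (d := Fin 3)) hμ.enstrophy_finite.ne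
  calc ENNReal.ofReal (∫ x, ⟪tgForce x, g x⟫_ℝ)
      ≤ ENNReal.ofReal (∫ v, |Torus.inertialPairing
          (v : Lp (EuclideanSpace ℝ (Fin 3)) 2 (volume : Measure (UnitAddTorus (Fin 3)))) g| ∂μ) :=
        ENNReal.ofReal_le_ofReal h1
    _ = ∫⁻ v, ENNReal.ofReal |Torus.inertialPairing
          (v : Lp (EuclideanSpace ℝ (Fin 3)) 2 (volume : Measure (UnitAddTorus (Fin 3)))) g| ∂μ :=
        ofReal_integral_eq_lintegral_ofReal hIi.abs (ae_of_all _ fun v => abs_nonneg _)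
    _ ≤ ∫⁻ v, Λ v ∂μ := by
        refine lintegral_mono_ae ?_
        filter_upwards [ae_mem_mirrorClass μ hK, hfin] with v hv hv'
        exact htube v hv hv'.ne

/-! ## Dirac masses: the steady enemies of the stub -/

/-- **Dirac characterisation.** The Dirac mass at `u ∈ H` is a K-supported stationary statistical solution of
Euler forced by `f_TG` if and only if `u` is mirror symmetric (`u ∈ Fix K`), has finite enstrophy, and is a
steady `H`-weak solution of forced Euler (`⟨f_TG − B(u,u), w⟩ = 0` for all `w ∈ 𝒱`). Forward:
`meanMomentumBalance` at `μ = δ_u`; backward: the tree fact `Torus.isStationaryStatisticalSolution_dirac`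
(FMRT 2001, Ch. IV §1.2; finite enstrophy puts `u` in `V`, `Torus.memSobolev_one_complexify_of_eGradNormSq_ne_top`).
So on Dirac masses the stub is EXACTLY "no steady weak Euler state of `f_TG` in `Fix K ∩ V`" — the `H¹` form of
`PumpedMirror.NoSmoothMirrorDodgerTG`. [folklore] -/
theorem dirac_iff :
    ∀ u : H3, (Measure.dirac u (closure mirrorClass)ᶜ = 0 ∧
        Torus.IsStationaryStatisticalSolution 0 tgForce (Measure.dirac u)) ↔
      (u ∈ mirrorClass ∧
        Torus.eGradNormSq ((u : Lp (EuclideanSpace ℝ (Fin 3)) 2 (volume : Measure (UnitAddTorus (Fin 3)))) :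
          UnitAddTorus (Fin 3) → EuclideanSpace ℝ (Fin 3)) ≠ ⊤ ∧
        Torus.IsSteadyWeakSolution 0 tgForce u) := by
  intro u
  constructor
  · rintro ⟨hK, hμ⟩
    refine ⟨?_, ?_, fun w hw hdw hzw => ?_⟩
    · by_contra hu
      rw [closure_mirrorClass_eq, Measure.dirac_apply' _ isClosed_mirrorClass.measurableSet.compl,
        Set.indicator_of_mem (Set.mem_compl hu), Pi.one_apply] at hK
      exact one_ne_zero hK
    · have h := hμ.enstrophy_finite
      rw [lintegral_dirac] at h
      exact h.ne
    · have h := (meanMomentumBalance tgForce w (Measure.dirac u) memLp_tgForce hw hdw hzw hμ).2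
      rwa [integral_dirac] at h
  · rintro ⟨hu, hG, hsteady⟩
    have hV : (u : Lp (EuclideanSpace ℝ (Fin 3)) 2 (volume : Measure (UnitAddTorus (Fin 3)))) ∈
        Torus.energySpaceV (Fin 3) :=
      ⟨u.2, Torus.memSobolev_one_complexify_of_eGradNormSq_ne_top (Lp.memLp _) hG⟩
    exact ⟨dirac_compl_closure_mirrorClass_of_mem (subset_closure hu),
      Torus.isStationaryStatisticalSolution_dirac_holds le_rfl memLp_tgForce (by simp) hV hsteady⟩

/-! ## The registered tools sub-stub -/

/-- **Tools sub-stub `stub_eulerCoerciveKTools`** of `stub_eulerCoerciveK` (line `regimes`, crux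
stmt-AnomalousDissipation-17693): the conjunction of the Kelvin-programme entry lemmas of this file — mean
momentum balance and mean Reynolds-stress balance of Euler statistics, stress pinning `−¼` and the energy floor
at `f_TG`, closedness of the mirror class and a.e. membership of K-supported measures, the loop circulation
`∮_C f_TG · dl = 4/π`, the Dirac characterisation, and the tube-inequality-to-skeleton-law glue. [folklore] -/
theorem stub_eulerCoerciveKTools :
    (∀ (f w : UnitAddTorus (Fin 3) → EuclideanSpace ℝ (Fin 3)) (μ : Measure H3), MemLp f 2 volume →
      Torus.IsSmooth w → Torus.IsDivFree w → Torus.HasZeroMean w →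
      Torus.IsStationaryStatisticalSolution 0 f μ →
      Integrable (fun v : H3 => Torus.nsGeneratorPairing 0 f v w) μ ∧
        ∫ v, Torus.nsGeneratorPairing 0 f v w ∂μ = 0) ∧
    (∀ (f w : UnitAddTorus (Fin 3) → EuclideanSpace ℝ (Fin 3)) (μ : Measure H3), MemLp f 2 volume →
      Torus.IsSmooth w → Torus.IsDivFree w → Torus.HasZeroMean w →
      Torus.IsStationaryStatisticalSolution 0 f μ →
      Integrable (fun v : H3 => Torus.inertialPairing
          (v : Lp (EuclideanSpace ℝ (Fin 3)) 2 (volume : Measure (UnitAddTorus (Fin 3)))) w) μ ∧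
        ∫ v, Torus.inertialPairing
            (v : Lp (EuclideanSpace ℝ (Fin 3)) 2 (volume : Measure (UnitAddTorus (Fin 3)))) w ∂μ =
          -∫ x, ⟪f x, w x⟫_ℝ) ∧
    (∀ μ : Measure H3, Torus.IsStationaryStatisticalSolution 0 tgForce μ →
      ∫ v, Torus.inertialPairing
          (v : Lp (EuclideanSpace ℝ (Fin 3)) 2 (volume : Measure (UnitAddTorus (Fin 3)))) tgForce ∂μ =
        -4⁻¹) ∧
    (∃ E₀ : ℝ, 0 < E₀ ∧ ∀ μ : Measure H3, Torus.IsStationaryStatisticalSolution 0 tgForce μ →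
      E₀ ≤ Torus.ensembleEnergy μ) ∧
    closure mirrorClass = mirrorClass ∧
    (∀ μ : Measure H3, μ (closure mirrorClass)ᶜ = 0 → ∀ᵐ v ∂μ, v ∈ mirrorClass) ∧
    ((∫ s in (0 : ℝ)..(1 / 2), tgForce (![((s : ℝ) : UnitAddCircle), ((0 : ℝ) : UnitAddCircle),
        ((0 : ℝ) : UnitAddCircle)]) 0) +
      (∫ s in (0 : ℝ)..(1 / 2), tgForce (![(((1 / 2 : ℝ)) : UnitAddCircle), ((s : ℝ) : UnitAddCircle),
        ((0 : ℝ) : UnitAddCircle)]) 1) -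
      (∫ s in (0 : ℝ)..(1 / 2), tgForce (![((s : ℝ) : UnitAddCircle), (((1 / 2 : ℝ)) : UnitAddCircle),
        ((0 : ℝ) : UnitAddCircle)]) 0) -
      (∫ s in (0 : ℝ)..(1 / 2), tgForce (![((0 : ℝ) : UnitAddCircle), ((s : ℝ) : UnitAddCircle),
        ((0 : ℝ) : UnitAddCircle)]) 1) = 4 / Real.pi) ∧
    (∀ u : H3, (Measure.dirac u (closure mirrorClass)ᶜ = 0 ∧
        Torus.IsStationaryStatisticalSolution 0 tgForce (Measure.dirac u)) ↔
      (u ∈ mirrorClass ∧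
        Torus.eGradNormSq ((u : Lp (EuclideanSpace ℝ (Fin 3)) 2 (volume : Measure (UnitAddTorus (Fin 3)))) :
          UnitAddTorus (Fin 3) → EuclideanSpace ℝ (Fin 3)) ≠ ⊤ ∧
        Torus.IsSteadyWeakSolution 0 tgForce u)) ∧
    (∀ (g : UnitAddTorus (Fin 3) → EuclideanSpace ℝ (Fin 3)) (Λ : H3 → ℝ≥0∞),
      Torus.IsSmooth g → Torus.IsDivFree g → Torus.HasZeroMean g →
      (∀ v : H3, v ∈ mirrorClass →
        Torus.eGradNormSq ((v : Lp (EuclideanSpace ℝ (Fin 3)) 2 (volume : Measure (UnitAddTorus (Fin 3)))) :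
          UnitAddTorus (Fin 3) → EuclideanSpace ℝ (Fin 3)) ≠ ⊤ →
        ENNReal.ofReal |Torus.inertialPairing
          (v : Lp (EuclideanSpace ℝ (Fin 3)) 2 (volume : Measure (UnitAddTorus (Fin 3)))) g| ≤ Λ v) →
      ∀ μ : Measure H3, μ (closure mirrorClass)ᶜ = 0 → Torus.IsStationaryStatisticalSolution 0 tgForce μ →
        ENNReal.ofReal (∫ x, ⟪tgForce x, g x⟫_ℝ) ≤ ∫⁻ v, Λ v ∂μ) :=
  ⟨meanMomentumBalance, meanReynoldsStress, meanStress_tg, energyFloor_tg, closure_mirrorClass_eq,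
    ae_mem_mirrorClass, tg_loop_circulation, dirac_iff, skeletonLaw_of_tubeInequality⟩

end Summit.AnomalousDissipation.AnomalousDissipation.Theorems.MirrorEnsembleMirrorStatisticsLoudTG

end
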